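import Mathlib.Analysis.InnerProductSpace.Laplacian
import Mathlib.Analysis.InnerProductSpace.PiL2
import Mathlib.Analysis.Calculus.ContDiff.Basic
import HarnessLib

/-!
# IsotropicBlobSphereGlue — plate G of ROUND-41 «IsotropicBlobPressureLaw» (S-door lane):
# gluing two functions along a sphere with matching 2-jets gives a `C²` function, with the glued
# derivatives and the glued Laplacian

For `f g : E → F` and a radius `R`, the glued function `sphereGlue R f g x := if ‖x‖ ≤ R then f x else g x`.

* `hasFDerivAt_sphereGlue`: if `f` (resp. `g`) is differentiable at every point of the closed ball (resp.
  of the closed exterior) with derivative `f'` (resp. `g'`), and on the sphere `f = g`, `f' = g'`, then the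
  glued function has derivative `sphereGlue R f' g'` EVERYWHERE (one-sided `HasFDerivWithinAt` + union).
* `contDiff_two_sphereGlue` (+ `fderiv_sphereGlue`, `fderiv_fderiv_sphereGlue`): `f` of class `C²` at
  every point of the closed ball, `g` at every point of the closed exterior, matching VALUES, FIRST and
  SECOND derivatives on the sphere `‖x‖ = R` ⇒ the glued function is `C²` on `E`, with glued derivatives.
* `laplacian_sphereGlue`: its Laplacian is the glued Laplacian `if ‖x‖ ≤ R then Δ f x else Δ g x`.
* `tendsto_sphereGlue_cocompact`: it inherits the behaviour of `g` at infinity.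

Use (ROUND-41, nsreg-p1 g33): the explicit blob pressure = interior polynomial glued to the exterior
multipole across the unit sphere; with plate E3 (`IsotropicBlobPoissonUnique`) it is THE decaying solution
of `Δp = −tr((∇u)²)`. Generic calculus; `--supports stmt-NavierStokesRegularity-0056 --as helper`.
HONEST FRAME: elementary gluing lemma; nothing about item 0056 `NoTypeII` or NS regularity is proved.
-/

set_option linter.dupNamespace false

open Set Function Filter Topology InnerProductSpace
open scoped Laplacian ContDiff

namespace Summit.NavierStokesRegularity.NavierStokesRegularity.Theorems.StrainDoors

namespace HarmonicShell

section Basic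

variable {E F : Type*} [NormedAddCommGroup E]

/-- support (definition): the function glued along the sphere of radius `R`: `f` on the closed ball,
`g` outside. -/
noncomputable def sphereGlue (R : ℝ) (f g : E → F) : E → F := fun x => if ‖x‖ ≤ R then f x else g x

/-- On the closed ball the glued function is `f`. -/
theorem sphereGlue_of_le {R : ℝ} {f g : E → F} {x : E} (h : ‖x‖ ≤ R) : sphereGlue R f g x = f x :=
  if_pos h

/-- Outside the closed ball the glued function is `g`. -/
theorem sphereGlue_of_lt {R : ℝ} {f g : E → F} {x : E} (h : R < ‖x‖) : sphereGlue R f g x = g x :=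
  if_neg (not_le.2 h)

/-- On the closed exterior the glued function is `g`, provided `f = g` on the sphere. -/
theorem sphereGlue_of_ge {R : ℝ} {f g : E → F} (h0 : ∀ x, ‖x‖ = R → f x = g x) {x : E}
    (h : R ≤ ‖x‖) : sphereGlue R f g x = g x := by
  rcases h.lt_or_eq with h' | h'
  · exact sphereGlue_of_lt h'
  · rw [sphereGlue_of_le h'.symm.le, h0 x h'.symm]

/-- In the open ball the glued function agrees with `f` near the point. -/
theorem sphereGlue_eventuallyEq_of_lt {R : ℝ} (f g : E → F) {x : E} (h : ‖x‖ < R) :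
    sphereGlue R f g =ᶠ[𝓝 x] f := by
  have hopen : IsOpen {y : E | ‖y‖ < R} := isOpen_lt continuous_norm continuous_const
  filter_upwards [hopen.mem_nhds h] with y hy
  exact sphereGlue_of_le (le_of_lt hy)

/-- In the open exterior the glued function agrees with `g` near the point. -/
theorem sphereGlue_eventuallyEq_of_gt {R : ℝ} (f g : E → F) {x : E} (h : R < ‖x‖) :
    sphereGlue R f g =ᶠ[𝓝 x] g := by
  have hopen : IsOpen {y : E | R < ‖y‖} := isOpen_lt continuous_const continuous_norm
  filter_upwards [hopen.mem_nhds h] with y hy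
  exact sphereGlue_of_lt hy

/-- The glued function inherits the behaviour of the exterior piece at infinity (proper spaces). -/
theorem tendsto_sphereGlue_cocompact [ProperSpace E] {R : ℝ} {f g : E → F} {l : Filter F}
    (hg : Tendsto g (cocompact E) l) : Tendsto (sphereGlue R f g) (cocompact E) l := by
  refine hg.congr' ?_
  have hmem : (Metric.closedBall (0 : E) R)ᶜ ∈ cocompact E :=
    (isCompact_closedBall (0 : E) R).compl_mem_cocompact
  filter_upwards [hmem] with x hx
  have hx' : R < ‖x‖ := by
    simpa [Metric.mem_closedBall, dist_zero_right] using hx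
  exact (sphereGlue_of_lt hx').symm

end Basic

section Cont

variable {E F : Type*} [NormedAddCommGroup E] [TopologicalSpace F]

/-- **Continuity of a glued function**: continuous pieces on the two closed sides agreeing on the sphere. -/
theorem continuous_sphereGlue {R : ℝ} {f g : E → F} (hf : ContinuousOn f {x : E | ‖x‖ ≤ R})
    (hg : ContinuousOn g {x : E | R ≤ ‖x‖}) (h0 : ∀ x, ‖x‖ = R → f x = g x) :
    Continuous (sphereGlue R f g) :=
  continuous_if_le continuous_norm continuous_const hf hg h0

end Cont

section Calculus

variable {E F : Type*} [NormedAddCommGroup E] [NormedSpace ℝ E] [NormedAddCommGroup F] [NormedSpace ℝ F]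

/-- **First-order gluing.** If `f` has derivative `f' x` at every point of the closed ball, `g` has
derivative `g' x` at every point of the closed exterior, and `f = g`, `f' = g'` on the sphere, then the
glued function has derivative `sphereGlue R f' g' x` at EVERY `x`. -/
theorem hasFDerivAt_sphereGlue {R : ℝ} {f g : E → F} {f' g' : E → E →L[ℝ] F}
    (hf : ∀ x, ‖x‖ ≤ R → HasFDerivAt f (f' x) x) (hg : ∀ x, R ≤ ‖x‖ → HasFDerivAt g (g' x) x)
    (h0 : ∀ x, ‖x‖ = R → f x = g x) (h1 : ∀ x, ‖x‖ = R → f' x = g' x) (x : E) :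
    HasFDerivAt (sphereGlue R f g) (sphereGlue R f' g' x) x := by
  rcases lt_trichotomy ‖x‖ R with hlt | heq | hgt
  · rw [sphereGlue_of_le hlt.le]
    exact (hf x hlt.le).congr_of_eventuallyEq (sphereGlue_eventuallyEq_of_lt f g hlt)
  · rw [sphereGlue_of_le heq.le]
    -- one-sided derivatives on the closed ball and on the closed exterior, then union
    have hs : HasFDerivWithinAt (sphereGlue R f g) (f' x) {y : E | ‖y‖ ≤ R} x :=
      (hf x heq.le).hasFDerivWithinAt.congr (fun y hy => sphereGlue_of_le hy) (sphereGlue_of_le heq.le)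
    have ht : HasFDerivWithinAt (sphereGlue R f g) (f' x) {y : E | R ≤ ‖y‖} x := by
      have := (hg x heq.symm.le).hasFDerivWithinAt (s := {y : E | R ≤ ‖y‖})
      rw [← h1 x heq] at this
      exact this.congr (fun y hy => sphereGlue_of_ge h0 hy) (sphereGlue_of_ge h0 heq.symm.le)
    have hu : ({y : E | ‖y‖ ≤ R} ∪ {y : E | R ≤ ‖y‖}) = univ :=
      eq_univ_of_forall fun y => (le_total ‖y‖ R).elim (fun h => Or.inl h) (fun h => Or.inr h)
    have := hs.union ht
    rw [hu] at this
    exact this.hasFDerivAt_of_univ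
  · rw [sphereGlue_of_lt hgt]
    exact (hg x hgt.le).congr_of_eventuallyEq (sphereGlue_eventuallyEq_of_gt f g hgt)


/-- **Second-order gluing.** `f` of class `C²` at every point of the closed ball, `g` of class `C²` at
every point of the closed exterior, with matching values, first AND second derivatives on the sphere
`‖x‖ = R`: the glued function is `C²`, its derivative is the glued derivative and its second
derivative is the glued second derivative. -/
theorem contDiff_two_sphereGlue_aux {R : ℝ} {f g : E → F}
    (hf : ∀ x, ‖x‖ ≤ R → ContDiffAt ℝ 2 f x) (hg : ∀ x, R ≤ ‖x‖ → ContDiffAt ℝ 2 g x)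
    (h0 : ∀ x, ‖x‖ = R → f x = g x) (h1 : ∀ x, ‖x‖ = R → fderiv ℝ f x = fderiv ℝ g x)
    (h2 : ∀ x, ‖x‖ = R → fderiv ℝ (fderiv ℝ f) x = fderiv ℝ (fderiv ℝ g) x) :
    ContDiff ℝ 2 (sphereGlue R f g) ∧
      (∀ x, HasFDerivAt (sphereGlue R f g) (sphereGlue R (fderiv ℝ f) (fderiv ℝ g) x) x) ∧
      (∀ x, HasFDerivAt (sphereGlue R (fderiv ℝ f) (fderiv ℝ g))
        (sphereGlue R (fderiv ℝ (fderiv ℝ f)) (fderiv ℝ (fderiv ℝ g)) x) x) := by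
  have two_ne : (2 : WithTop ℕ∞) ≠ 0 := by norm_num
  -- first derivatives of the pieces
  have hf1 : ∀ x, ‖x‖ ≤ R → HasFDerivAt f (fderiv ℝ f x) x := fun x hx =>
    ((hf x hx).differentiableAt two_ne).hasFDerivAt
  have hg1 : ∀ x, R ≤ ‖x‖ → HasFDerivAt g (fderiv ℝ g x) x := fun x hx =>
    ((hg x hx).differentiableAt two_ne).hasFDerivAt
  -- the derivatives are `C¹`
  have hf1c : ∀ x, ‖x‖ ≤ R → ContDiffAt ℝ 1 (fderiv ℝ f) x := fun x hx =>
    (hf x hx).fderiv_right (m := 1) (by norm_num)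
  have hg1c : ∀ x, R ≤ ‖x‖ → ContDiffAt ℝ 1 (fderiv ℝ g) x := fun x hx =>
    (hg x hx).fderiv_right (m := 1) (by norm_num)
  have hf2 : ∀ x, ‖x‖ ≤ R → HasFDerivAt (fderiv ℝ f) (fderiv ℝ (fderiv ℝ f) x) x := fun x hx =>
    ((hf1c x hx).differentiableAt one_ne_zero).hasFDerivAt
  have hg2 : ∀ x, R ≤ ‖x‖ → HasFDerivAt (fderiv ℝ g) (fderiv ℝ (fderiv ℝ g) x) x := fun x hx =>
    ((hg1c x hx).differentiableAt one_ne_zero).hasFDerivAt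
  -- the second derivatives are continuous on the closed sides
  have hf2c : ContinuousOn (fderiv ℝ (fderiv ℝ f)) {x : E | ‖x‖ ≤ R} := fun x hx =>
    ((hf1c x hx).fderiv_right (m := 0) (by norm_num)).continuousAt.continuousWithinAt
  have hg2c : ContinuousOn (fderiv ℝ (fderiv ℝ g)) {x : E | R ≤ ‖x‖} := fun x hx =>
    ((hg1c x hx).fderiv_right (m := 0) (by norm_num)).continuousAt.continuousWithinAt
  -- glue twice
  have hF : ∀ x, HasFDerivAt (sphereGlue R f g) (sphereGlue R (fderiv ℝ f) (fderiv ℝ g) x) x :=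
    hasFDerivAt_sphereGlue hf1 hg1 h0 h1
  have hF' : ∀ x, HasFDerivAt (sphereGlue R (fderiv ℝ f) (fderiv ℝ g))
      (sphereGlue R (fderiv ℝ (fderiv ℝ f)) (fderiv ℝ (fderiv ℝ g)) x) x :=
    hasFDerivAt_sphereGlue hf2 hg2 h1 h2
  have hF''c : Continuous (sphereGlue R (fderiv ℝ (fderiv ℝ f)) (fderiv ℝ (fderiv ℝ g))) :=
    continuous_sphereGlue hf2c hg2c h2
  refine ⟨?_, hF, hF'⟩
  have h1' : ContDiff ℝ 1 (sphereGlue R (fderiv ℝ f) (fderiv ℝ g)) :=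
    contDiff_one_iff_hasFDerivAt.2 ⟨_, hF''c, hF'⟩
  have : ContDiff ℝ ((1 : ℕ) + 1) (sphereGlue R f g) :=
    contDiff_succ_iff_hasFDerivAt.2 ⟨_, h1', hF⟩
  simpa [one_add_one_eq_two] using this

/-- **Plate G «SphereGlue», `C²` form.** Matching 2-jets on the sphere ⇒ the glued function is `C²`. -/
theorem contDiff_two_sphereGlue {R : ℝ} {f g : E → F}
    (hf : ∀ x, ‖x‖ ≤ R → ContDiffAt ℝ 2 f x) (hg : ∀ x, R ≤ ‖x‖ → ContDiffAt ℝ 2 g x)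
    (h0 : ∀ x, ‖x‖ = R → f x = g x) (h1 : ∀ x, ‖x‖ = R → fderiv ℝ f x = fderiv ℝ g x)
    (h2 : ∀ x, ‖x‖ = R → fderiv ℝ (fderiv ℝ f) x = fderiv ℝ (fderiv ℝ g) x) :
    ContDiff ℝ 2 (sphereGlue R f g) :=
  (contDiff_two_sphereGlue_aux hf hg h0 h1 h2).1

/-- The derivative of the glued function is the glued derivative. -/
theorem fderiv_sphereGlue {R : ℝ} {f g : E → F}
    (hf : ∀ x, ‖x‖ ≤ R → ContDiffAt ℝ 2 f x) (hg : ∀ x, R ≤ ‖x‖ → ContDiffAt ℝ 2 g x)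
    (h0 : ∀ x, ‖x‖ = R → f x = g x) (h1 : ∀ x, ‖x‖ = R → fderiv ℝ f x = fderiv ℝ g x)
    (h2 : ∀ x, ‖x‖ = R → fderiv ℝ (fderiv ℝ f) x = fderiv ℝ (fderiv ℝ g) x) (x : E) :
    fderiv ℝ (sphereGlue R f g) x = if ‖x‖ ≤ R then fderiv ℝ f x else fderiv ℝ g x :=
  ((contDiff_two_sphereGlue_aux hf hg h0 h1 h2).2.1 x).fderiv

/-- The second derivative of the glued function is the glued second derivative. -/
theorem fderiv_fderiv_sphereGlue {R : ℝ} {f g : E → F}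
    (hf : ∀ x, ‖x‖ ≤ R → ContDiffAt ℝ 2 f x) (hg : ∀ x, R ≤ ‖x‖ → ContDiffAt ℝ 2 g x)
    (h0 : ∀ x, ‖x‖ = R → f x = g x) (h1 : ∀ x, ‖x‖ = R → fderiv ℝ f x = fderiv ℝ g x)
    (h2 : ∀ x, ‖x‖ = R → fderiv ℝ (fderiv ℝ f) x = fderiv ℝ (fderiv ℝ g) x) (x : E) :
    fderiv ℝ (fderiv ℝ (sphereGlue R f g)) x =
      if ‖x‖ ≤ R then fderiv ℝ (fderiv ℝ f) x else fderiv ℝ (fderiv ℝ g) x := by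
  obtain ⟨-, hF, hF'⟩ := contDiff_two_sphereGlue_aux hf hg h0 h1 h2
  have hfd : fderiv ℝ (sphereGlue R f g) = sphereGlue R (fderiv ℝ f) (fderiv ℝ g) :=
    funext fun y => (hF y).fderiv
  rw [hfd]
  exact (hF' x).fderiv


end Calculus

section Laplace

variable {E F : Type*} [NormedAddCommGroup E] [InnerProductSpace ℝ E] [FiniteDimensional ℝ E]
  [NormedAddCommGroup F] [NormedSpace ℝ F]

/-- **Plate G «SphereGlue», Laplacian form.** Under matching 2-jets on the sphere, the Laplacian of the
glued function is the glued Laplacian. -/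
theorem laplacian_sphereGlue {R : ℝ} {f g : E → F}
    (hf : ∀ x, ‖x‖ ≤ R → ContDiffAt ℝ 2 f x) (hg : ∀ x, R ≤ ‖x‖ → ContDiffAt ℝ 2 g x)
    (h0 : ∀ x, ‖x‖ = R → f x = g x) (h1 : ∀ x, ‖x‖ = R → fderiv ℝ f x = fderiv ℝ g x)
    (h2 : ∀ x, ‖x‖ = R → fderiv ℝ (fderiv ℝ f) x = fderiv ℝ (fderiv ℝ g) x) (x : E) :
    Δ (sphereGlue R f g) x = if ‖x‖ ≤ R then Δ f x else Δ g x := by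
  have key := fderiv_fderiv_sphereGlue hf hg h0 h1 h2 x
  rw [laplacian_eq_iteratedFDeriv_stdOrthonormalBasis (sphereGlue R f g),
    laplacian_eq_iteratedFDeriv_stdOrthonormalBasis f, laplacian_eq_iteratedFDeriv_stdOrthonormalBasis g]
  simp only [iteratedFDeriv_two_apply, key]
  split_ifs <;> rfl

/-- Under matching 2-jets, the glued Laplacian in «source» form: if `Δ f = ρ` on the closed ball and
`Δ g = σ` on the closed exterior then `Δ (sphereGlue R f g) x = if ‖x‖ ≤ R then ρ x else σ x`. -/
theorem laplacian_sphereGlue_eq {R : ℝ} {f g : E → F} {ρ σ : E → F}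
    (hf : ∀ x, ‖x‖ ≤ R → ContDiffAt ℝ 2 f x) (hg : ∀ x, R ≤ ‖x‖ → ContDiffAt ℝ 2 g x)
    (h0 : ∀ x, ‖x‖ = R → f x = g x) (h1 : ∀ x, ‖x‖ = R → fderiv ℝ f x = fderiv ℝ g x)
    (h2 : ∀ x, ‖x‖ = R → fderiv ℝ (fderiv ℝ f) x = fderiv ℝ (fderiv ℝ g) x)
    (hρ : ∀ x, ‖x‖ ≤ R → Δ f x = ρ x) (hσ : ∀ x, R < ‖x‖ → Δ g x = σ x) (x : E) :
    Δ (sphereGlue R f g) x = if ‖x‖ ≤ R then ρ x else σ x := by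
  rw [laplacian_sphereGlue hf hg h0 h1 h2 x]
  split_ifs with h
  · exact hρ x h
  · exact hσ x (not_le.1 h)

end Laplace

end HarmonicShell

end Summit.NavierStokesRegularity.NavierStokesRegularity.Theorems.StrainDoors
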